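import Summits.CriticalPhenomena.PercolationContinuityZ3.Theorems.PercNearOneGluingAdditiveGluingFingerReachUnion
import Summits.CriticalPhenomena.PercolationContinuityZ3.Theorems.PercNearOneGluingAdditiveGluingLincombIntegral
import HarnessLib

/-! # Crux `PercNearOneGluing.AdditiveGluing` (stmt-CriticalPhenomena-4576) — tools for the two-contact finger multi-edge Lemma 3 with
# fingers touching the target, part A: sub-triangle reachability (seat (b) V⁺-form, depth prover `png-dp-vplus`)

Support file (`--supports stmt-CriticalPhenomena-4576`); no definitions, no named facts.  Bookkeeping for
`…AdditiveGluingFingerTwoContactsB.lean` (the last `|A| = 4` case of the registered open stub `stub_fingerML3_vp`: two base-weak contact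
relays `w₁, w₂`, fingers may also touch `b`).

* `tcb_reach_union_tri_iff`: reachability of `b` after adding a sub-triangle of virtual pairs on `{w₁, w₂, b}` (the bridge graph of an
  un-glued pattern, or the clique of a glued one), in terms of base reachability; `tcb_bridgeSet_eq_tri`, `tcb_cliqueSet_eq_tri` identify the
  bridge / clique sets of a contact pattern with such a sub-triangle; `tcb_tri_formula_*` collapse the formula into the five connectivity events.
* `tcb_nest5_sum`, `tcb_triple_sum`, `tcb_glued_shape`, `tcb_cross_*`, `tcb_noBridge_shape`: nested-`if` pattern-sum algebra (aggregated masses).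
* `tcb_swap_sum_le`: the COORDINATE-BLOCK SWAP inequality `(Σ_A w)(Σ_B w) ≤ (Σ_C w)(Σ_D w)` for product weights, via the weight-preserving
  injection `(J, J') ↦ (J' ∩ F₁₂, J ∪ (J' ∩ F_b))` — the finger-side inequality `p₁·B₁b' ≤ (1 − B₁)·Q₁b` of the certificate.
* `tcb_twoContactsB_pointwise`: the pointwise bookkeeping of the certificate on the 15 connectivity classes of `{b, d, w₁, w₂}` (generated
  decision tree, one leaf inequality `hR*` per class), to be integrated with `stub_lincombIntegral_c7`.
[cite: KozmaNitzan2024, Lemma 3 (pp. 6–7), §3.1, §3.2 pp. 12–14, §4 p. 20; Grimmett1999, §1.3, §2.2]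
-/

namespace Summit.CriticalPhenomena.PercolationContinuityZ3.Theorems

open MeasureTheory Set
open Literature.Probability.LatticeModels (prodBernoulli)
open Literature.Probability.Percolation

noncomputable section
open Classical

section TwoContactsBTools

variable {n : ℕ}


/-- Two virtual pairs sharing the hub `x` make `{x, y, z}` mutually reachable. [folklore] -/
theorem tcb_hub_connected {Q : Set (Sym2 (Fin n))} (x y z : Fin n) (hxy : x ≠ y) (hxz : x ≠ z)
    (hy : s(x, y) ∈ Q) (hz : s(x, z) ∈ Q) :
    ∀ u ∈ ({x, y, z} : Finset (Fin n)), ∀ v ∈ ({x, y, z} : Finset (Fin n)),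
      (openGraph (Q : BondConfig (Fin n))).Reachable u v := by
  have hxy' : (openGraph (Q : BondConfig (Fin n))).Reachable x y := ((openGraph_adj Q x y).2 ⟨hy, hxy⟩).reachable
  have hxz' : (openGraph (Q : BondConfig (Fin n))).Reachable x z := ((openGraph_adj Q x z).2 ⟨hz, hxz⟩).reachable
  have hx : ∀ v ∈ ({x, y, z} : Finset (Fin n)), (openGraph (Q : BondConfig (Fin n))).Reachable x v := by
    intro v hv
    simp only [Finset.mem_insert, Finset.mem_singleton] at hv
    rcases hv with rfl | rfl | rfl
    · exact SimpleGraph.Reachable.refl _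
    · exact hxy'
    · exact hxz'
  intro u hu v hv
  exact (hx u hu).symm.trans (hx v hv)

/-- **Reachability of `b` after adding a sub-triangle of virtual pairs on `{w₁, w₂, b}`.**  With
`Q = {s(w₁,w₂) if β₁₂} ∪ {s(w₁,b) if β₁} ∪ {s(w₂,b) if β₂}`:  `y ↔ b` in `ω' ∪ Q` iff
`y ↔ b`, or `y ↔ w₁` and `w₁` is joined to `b` through `Q` (directly, or via `w₂` and then `Q` or `ω'`), or the same with
`w₂`. [folklore] -/
theorem tcb_reach_union_tri_iff (ω' : Set (Sym2 (Fin n))) (w₁ w₂ b : Fin n) (h12 : w₁ ≠ w₂) (h1b : w₁ ≠ b) (h2b : w₂ ≠ b)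
    (β12 β1 β2 : Prop) (y : Fin n) :
    (openGraph ((ω' ∪ {e : Sym2 (Fin n) | (e = s(w₁, w₂) ∧ β12) ∨ (e = s(w₁, b) ∧ β1) ∨ (e = s(w₂, b) ∧ β2)} :
        Set (Sym2 (Fin n))) : BondConfig (Fin n))).Reachable y b ↔
      ((openGraph (ω' : BondConfig (Fin n))).Reachable y b ∨
        ((β1 ∨ (β12 ∧ (β2 ∨ (openGraph (ω' : BondConfig (Fin n))).Reachable w₂ b))) ∧
          (openGraph (ω' : BondConfig (Fin n))).Reachable y w₁) ∨
        ((β2 ∨ (β12 ∧ (β1 ∨ (openGraph (ω' : BondConfig (Fin n))).Reachable w₁ b))) ∧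
          (openGraph (ω' : BondConfig (Fin n))).Reachable y w₂)) := by
  set G := openGraph (ω' : BondConfig (Fin n)) with hG
  set Q : Set (Sym2 (Fin n)) := {e : Sym2 (Fin n) | (e = s(w₁, w₂) ∧ β12) ∨ (e = s(w₁, b) ∧ β1) ∨ (e = s(w₂, b) ∧ β2)} with hQ
  have hQW : ∀ e ∈ Q, ∀ z ∈ e, z ∈ ({w₁, w₂, b} : Finset (Fin n)) := by
    intro e he z hz
    rcases he with ⟨rfl, -⟩ | ⟨rfl, -⟩ | ⟨rfl, -⟩ <;> rcases Sym2.mem_iff.1 hz with rfl | rfl <;> simp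
  -- the case of at least two virtual pairs: `{w₁, w₂, b}` is `Q`-connected
  have hconn_case : (∀ u ∈ ({w₁, w₂, b} : Finset (Fin n)), ∀ v ∈ ({w₁, w₂, b} : Finset (Fin n)),
      (openGraph (Q : BondConfig (Fin n))).Reachable u v) →
      ((openGraph ((ω' ∪ Q : Set (Sym2 (Fin n))) : BondConfig (Fin n))).Reachable y b ↔
        (G.Reachable y b ∨ G.Reachable y w₁ ∨ G.Reachable y w₂)) := by
    intro hconn
    rw [reach_union_connected_iff hQW hconn y b]
    constructor
    · rintro (h | ⟨⟨x, hx, hyx⟩, -⟩)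
      · exact Or.inl h
      · simp only [Finset.mem_insert, Finset.mem_singleton] at hx
        rcases hx with rfl | rfl | rfl
        · exact Or.inr (Or.inl hyx)
        · exact Or.inr (Or.inr hyx)
        · exact Or.inl hyx
    · rintro (h | h | h)
      · exact Or.inl h
      · exact Or.inr ⟨⟨w₁, by simp, h⟩, ⟨b, by simp, SimpleGraph.Reachable.refl _⟩⟩
      · exact Or.inr ⟨⟨w₂, by simp, h⟩, ⟨b, by simp, SimpleGraph.Reachable.refl _⟩⟩
  by_cases c12 : β12 <;> by_cases c1 : β1 <;> by_cases c2 : β2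
  · -- all three pairs
    have hconn := tcb_hub_connected (Q := Q) w₁ w₂ b h12 h1b (by simp [hQ, c12]) (by simp [hQ, c1])
    rw [hconn_case hconn]
    simp only [c12, c1, c2, true_or, or_true, true_and, and_true]
  · -- `12`, `1b`
    have hconn := tcb_hub_connected (Q := Q) w₁ w₂ b h12 h1b (by simp [hQ, c12]) (by simp [hQ, c1])
    rw [hconn_case hconn]
    simp only [c12, c1, c2, true_or, or_true, true_and, false_or]
  · -- `12`, `2b`
    have hconn := tcb_hub_connected (Q := Q) w₂ w₁ b h12.symm h2b (by rw [Sym2.eq_swap]; simp [hQ, c12]) (by simp [hQ, c2])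
    have hconn' : ∀ u ∈ ({w₁, w₂, b} : Finset (Fin n)), ∀ v ∈ ({w₁, w₂, b} : Finset (Fin n)),
        (openGraph (Q : BondConfig (Fin n))).Reachable u v := by
      intro u hu v hv
      refine hconn u ?_ v ?_ <;> simp only [Finset.mem_insert, Finset.mem_singleton] at hu hv ⊢ <;> tauto
    rw [hconn_case hconn']
    simp only [c12, c1, c2, true_or, or_true, true_and, false_or]
  · -- only `12`
    have hQeq : (ω' ∪ Q : Set (Sym2 (Fin n))) = ω' ∪ {s(w₁, w₂)} := by
      congr 1
      ext e
      simp only [hQ, Set.mem_setOf_eq, Set.mem_singleton_iff, c12, c1, c2, and_true, and_false, or_false]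
    rw [hQeq, reach_union_pair_iff w₁ w₂ h12 y b]
    simp only [c12, c1, c2, false_or, true_and]
    constructor
    · rintro (h | ⟨hy, hb⟩)
      · exact Or.inl h
      · rcases hy with hy | hy <;> rcases hb with hb | hb
        · exact Or.inl (hy.trans hb)
        · exact Or.inr (Or.inl ⟨hb, hy⟩)
        · exact Or.inr (Or.inr ⟨hb, hy⟩)
        · exact Or.inl (hy.trans hb)
    · rintro (h | ⟨hb, hy⟩ | ⟨hb, hy⟩)
      · exact Or.inl h
      · exact Or.inr ⟨Or.inl hy, Or.inr hb⟩
      · exact Or.inr ⟨Or.inr hy, Or.inl hb⟩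
  · -- `1b`, `2b`
    have hconn := tcb_hub_connected (Q := Q) b w₁ w₂ h1b.symm h2b.symm (by rw [Sym2.eq_swap]; simp [hQ, c1])
      (by rw [Sym2.eq_swap]; simp [hQ, c2])
    have hconn' : ∀ u ∈ ({w₁, w₂, b} : Finset (Fin n)), ∀ v ∈ ({w₁, w₂, b} : Finset (Fin n)),
        (openGraph (Q : BondConfig (Fin n))).Reachable u v := by
      intro u hu v hv
      refine hconn u ?_ v ?_ <;> simp only [Finset.mem_insert, Finset.mem_singleton] at hu hv ⊢ <;> tauto
    rw [hconn_case hconn']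
    simp only [c12, c1, c2, true_or, true_and]
  · -- only `1b`
    have hQeq : (ω' ∪ Q : Set (Sym2 (Fin n))) = ω' ∪ {s(w₁, b)} := by
      congr 1
      ext e
      simp only [hQ, Set.mem_setOf_eq, Set.mem_singleton_iff, c12, c1, c2, and_true, and_false, or_false, false_or]
    rw [hQeq, reach_union_pair_iff w₁ b h1b y b]
    simp only [c12, c1, c2, false_or, true_and, false_and, or_false, true_or]
    constructor
    · rintro (h | ⟨hy, hb⟩)
      · exact Or.inl h
      · rcases hy with hy | hy
        · exact Or.inr hy
        · exact Or.inl hy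
    · rintro (h | hy)
      · exact Or.inl h
      · exact Or.inr ⟨Or.inl hy, Or.inr (SimpleGraph.Reachable.refl _)⟩
  · -- only `2b`
    have hQeq : (ω' ∪ Q : Set (Sym2 (Fin n))) = ω' ∪ {s(w₂, b)} := by
      congr 1
      ext e
      simp only [hQ, Set.mem_setOf_eq, Set.mem_singleton_iff, c12, c1, c2, and_true, and_false, false_or]
    rw [hQeq, reach_union_pair_iff w₂ b h2b y b]
    simp only [c12, c1, c2, false_or, true_and, false_and, or_false, true_or]
    constructor
    · rintro (h | ⟨hy, hb⟩)
      · exact Or.inl h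
      · rcases hy with hy | hy
        · exact Or.inr hy
        · exact Or.inl hy
    · rintro (h | hy)
      · exact Or.inl h
      · exact Or.inr ⟨Or.inl hy, Or.inr (SimpleGraph.Reachable.refl _)⟩
  · -- no virtual pair
    have hQeq : (ω' ∪ Q : Set (Sym2 (Fin n))) = ω' ∪ (∅ : Set (Sym2 (Fin n))) := by
      congr 1
      ext e
      simp only [hQ, Set.mem_setOf_eq, Set.mem_empty_iff_false, c12, c1, c2, and_false, or_false]
    rw [hQeq, reach_union_empty_iff y b]
    simp only [c12, c1, c2, false_or, false_and, or_false]
    exact Iff.rfl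

/-- The bridge set of a pattern `J` of contact pairs to `w₁, w₂, b` (fingers `v ∈ N`): it is the sub-triangle on `{w₁, w₂, b}`
selected by the three "some finger has both contacts in `J`" predicates. [folklore] -/
theorem tcb_bridgeSet_eq_tri (N : Finset (Fin n)) (w₁ w₂ b : Fin n) (hw₁ : w₁ ∉ N) (hw₂ : w₂ ∉ N) (hbN : b ∉ N)
    (h12 : w₁ ≠ w₂) (h1b : w₁ ≠ b) (h2b : w₂ ≠ b) (J : Finset (Sym2 (Fin n)))
    (hJ : ∀ e ∈ J, ∃ v ∈ N, e = s(v, w₁) ∨ e = s(v, w₂) ∨ e = s(v, b)) :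
    {e : Sym2 (Fin n) | ∃ v ∈ N, ∃ w w' : Fin n, w ∉ N ∧ w' ∉ N ∧ w ≠ w' ∧ s(v, w) ∈ J ∧ s(v, w') ∈ J ∧ e = s(w, w')} =
      {e : Sym2 (Fin n) | (e = s(w₁, w₂) ∧ ∃ v ∈ N, s(v, w₁) ∈ J ∧ s(v, w₂) ∈ J) ∨
        (e = s(w₁, b) ∧ ∃ v ∈ N, s(v, w₁) ∈ J ∧ s(v, b) ∈ J) ∨ (e = s(w₂, b) ∧ ∃ v ∈ N, s(v, w₂) ∈ J ∧ s(v, b) ∈ J)} := by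
  -- the second endpoint of a contact pair of `v ∈ N` lying in `J` is one of `w₁, w₂, b`
  have hend : ∀ v ∈ N, ∀ w : Fin n, w ∉ N → s(v, w) ∈ J → (w = w₁ ∨ w = w₂ ∨ w = b) := by
    intro v hv w hw he
    obtain ⟨v', hv', h⟩ := hJ _ he
    have key : ∀ x : Fin n, s(v, w) = s(v', x) → w = x := by
      intro x hx
      rcases Sym2.eq_iff.1 hx with ⟨-, h2⟩ | ⟨h1, h2⟩
      · exact h2
      · exact absurd (show w ∈ N by rw [h2]; exact hv') hw
    rcases h with h | h | h
    · exact Or.inl (key _ h)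
    · exact Or.inr (Or.inl (key _ h))
    · exact Or.inr (Or.inr (key _ h))
  ext e
  simp only [Set.mem_setOf_eq]
  constructor
  · rintro ⟨v, hv, w, w', hw, hw', hne, hvw, hvw', rfl⟩
    rcases hend v hv w hw hvw with rfl | rfl | rfl <;> rcases hend v hv w' hw' hvw' with rfl | rfl | rfl
    · exact absurd rfl hne
    · exact Or.inl ⟨rfl, v, hv, hvw, hvw'⟩
    · exact Or.inr (Or.inl ⟨rfl, v, hv, hvw, hvw'⟩)
    · exact Or.inl ⟨Sym2.eq_swap, v, hv, hvw', hvw⟩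
    · exact absurd rfl hne
    · exact Or.inr (Or.inr ⟨rfl, v, hv, hvw, hvw'⟩)
    · exact Or.inr (Or.inl ⟨Sym2.eq_swap, v, hv, hvw', hvw⟩)
    · exact Or.inr (Or.inr ⟨Sym2.eq_swap, v, hv, hvw', hvw⟩)
    · exact absurd rfl hne
  · rintro (⟨rfl, v, hv, h, h'⟩ | ⟨rfl, v, hv, h, h'⟩ | ⟨rfl, v, hv, h, h'⟩)
    · exact ⟨v, hv, w₁, w₂, hw₁, hw₂, h12, h, h', rfl⟩
    · exact ⟨v, hv, w₁, b, hw₁, hbN, h1b, h, h', rfl⟩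
    · exact ⟨v, hv, w₂, b, hw₂, hbN, h2b, h, h', rfl⟩

/-- The clique set on the touched points of a pattern `J` of contact pairs to `w₁, w₂, b`: the sub-triangle selected by the
pairwise "both touched" predicates. [folklore] -/
theorem tcb_cliqueSet_eq_tri (N : Finset (Fin n)) (w₁ w₂ b : Fin n) (hw₁ : w₁ ∉ N) (hw₂ : w₂ ∉ N) (hbN : b ∉ N)
    (h12 : w₁ ≠ w₂) (h1b : w₁ ≠ b) (h2b : w₂ ≠ b) (J : Finset (Sym2 (Fin n)))
    (hJ : ∀ e ∈ J, ∃ v ∈ N, e = s(v, w₁) ∨ e = s(v, w₂) ∨ e = s(v, b)) :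
    {e : Sym2 (Fin n) | ∃ w w' : Fin n, w ∉ N ∧ w' ∉ N ∧ w ≠ w' ∧ (∃ v ∈ N, s(v, w) ∈ J) ∧ (∃ v ∈ N, s(v, w') ∈ J) ∧
        e = s(w, w')} =
      {e : Sym2 (Fin n) | (e = s(w₁, w₂) ∧ ((∃ v ∈ N, s(v, w₁) ∈ J) ∧ ∃ v ∈ N, s(v, w₂) ∈ J)) ∨
        (e = s(w₁, b) ∧ ((∃ v ∈ N, s(v, w₁) ∈ J) ∧ ∃ v ∈ N, s(v, b) ∈ J)) ∨
        (e = s(w₂, b) ∧ ((∃ v ∈ N, s(v, w₂) ∈ J) ∧ ∃ v ∈ N, s(v, b) ∈ J))} := by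
  have hend : ∀ v ∈ N, ∀ w : Fin n, w ∉ N → s(v, w) ∈ J → (w = w₁ ∨ w = w₂ ∨ w = b) := by
    intro v hv w hw he
    obtain ⟨v', hv', h⟩ := hJ _ he
    have key : ∀ x : Fin n, s(v, w) = s(v', x) → w = x := by
      intro x hx
      rcases Sym2.eq_iff.1 hx with ⟨-, h2⟩ | ⟨h1, h2⟩
      · exact h2
      · exact absurd (show w ∈ N by rw [h2]; exact hv') hw
    rcases h with h | h | h
    · exact Or.inl (key _ h)
    · exact Or.inr (Or.inl (key _ h))
    · exact Or.inr (Or.inr (key _ h))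
  ext e
  simp only [Set.mem_setOf_eq]
  constructor
  · rintro ⟨w, w', hw, hw', hne, ⟨v, hv, hvw⟩, ⟨v', hv', hvw'⟩, rfl⟩
    rcases hend v hv w hw hvw with rfl | rfl | rfl <;> rcases hend v' hv' w' hw' hvw' with rfl | rfl | rfl
    · exact absurd rfl hne
    · exact Or.inl ⟨rfl, ⟨v, hv, hvw⟩, ⟨v', hv', hvw'⟩⟩
    · exact Or.inr (Or.inl ⟨rfl, ⟨v, hv, hvw⟩, ⟨v', hv', hvw'⟩⟩)
    · exact Or.inl ⟨Sym2.eq_swap, ⟨v', hv', hvw'⟩, ⟨v, hv, hvw⟩⟩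
    · exact absurd rfl hne
    · exact Or.inr (Or.inr ⟨rfl, ⟨v, hv, hvw⟩, ⟨v', hv', hvw'⟩⟩)
    · exact Or.inr (Or.inl ⟨Sym2.eq_swap, ⟨v', hv', hvw'⟩, ⟨v, hv, hvw⟩⟩)
    · exact Or.inr (Or.inr ⟨Sym2.eq_swap, ⟨v', hv', hvw'⟩, ⟨v, hv, hvw⟩⟩)
    · exact absurd rfl hne
  · rintro (⟨rfl, h, h'⟩ | ⟨rfl, h, h'⟩ | ⟨rfl, h, h'⟩)
    · exact ⟨w₁, w₂, hw₁, hw₂, h12, h, h', rfl⟩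
    · exact ⟨w₁, b, hw₁, hbN, h1b, h, h', rfl⟩
    · exact ⟨w₂, b, hw₂, hbN, h2b, h, h', rfl⟩

/-- Collapse of the sub-triangle reachability formula of `tcb_reach_union_tri_iff` for `y = d` into the five connectivity events used by
the certificate (classes: at least two virtual pairs / only `w₁w₂` / only `w₁b` / only `w₂b` / none). [folklore] -/
theorem tcb_tri_formula_d (β12 β1 β2 Rdb R1b R2b Rd1 Rd2 : Prop) :
    (Rdb ∨ ((β1 ∨ (β12 ∧ (β2 ∨ R2b))) ∧ Rd1) ∨ ((β2 ∨ (β12 ∧ (β1 ∨ R1b))) ∧ Rd2)) ↔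
      (if ((β12 ∧ β1) ∨ (β12 ∧ β2) ∨ (β1 ∧ β2)) then (Rdb ∨ Rd1 ∨ Rd2)
        else if β12 then (Rdb ∨ (R2b ∧ Rd1) ∨ (R1b ∧ Rd2))
        else if β1 then (Rdb ∨ Rd1) else if β2 then (Rdb ∨ Rd2) else Rdb) := by
  split_ifs <;> tauto

/-- The same collapse for `y = w₁` (where `w₁ ↔ w₁` holds). [folklore] -/
theorem tcb_tri_formula_w1 (β12 β1 β2 R1b R2b R12 : Prop) :
    (R1b ∨ ((β1 ∨ (β12 ∧ (β2 ∨ R2b))) ∧ True) ∨ ((β2 ∨ (β12 ∧ (β1 ∨ R1b))) ∧ R12)) ↔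
      (if ((β12 ∧ β1) ∨ (β12 ∧ β2) ∨ (β1 ∧ β2)) then True
        else if β12 then (R1b ∨ R2b)
        else if β1 then True else if β2 then (R1b ∨ R12) else R1b) := by
  split_ifs <;> tauto

/-- The same collapse for `y = w₂`. [folklore] -/
theorem tcb_tri_formula_w2 (β12 β1 β2 R1b R2b R12 : Prop) :
    (R2b ∨ ((β1 ∨ (β12 ∧ (β2 ∨ R2b))) ∧ R12) ∨ ((β2 ∨ (β12 ∧ (β1 ∨ R1b))) ∧ True)) ↔
      (if ((β12 ∧ β1) ∨ (β12 ∧ β2) ∨ (β1 ∧ β2)) then True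
        else if β12 then (R1b ∨ R2b)
        else if β1 then (R2b ∨ R12) else if β2 then True else R2b) := by
  split_ifs <;> tauto





end TwoContactsBTools

end

end Summit.CriticalPhenomena.PercolationContinuityZ3.Theorems
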